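import Summits.BirchSwinnertonDyer.BirchSwinnertonDyer.Theses.KatoDescentTamePotSupersingular
import Summits.BirchSwinnertonDyer.BirchSwinnertonDyer.Theses.KatoDescentPotSupersingular
import Literature.NumberTheory.EllipticCurves.Jetchev2008.HeegnerPointGlobalDivisibility
import Literature.NumberTheory.EllipticCurves.KolyvaginShaStructureDivisibility
import Literature.NumberTheory.EllipticCurves.MatarNekovar2019.ShaIndexBoundIrreducible
import HarnessLib

/-!
**STATUS (plan g21, 2026-08-27T06:2xZ): ALTERNATIVE LINE, NOT THE RECORD.** The skeleton OF RECORD for crux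
20165 is `Lines/birth.lean` = k8t-c4 g8's cut (stubs `stub_structureIrred` / `stub_divisibilityIrredAddv` /
`stub_publishedInputsHeegner`, composition LANDED as p502280
`Theorems/KatoDescentTamePotSupersingularJetchevIrreducibleReadingOfStubs.lean`). This file is the same
mathematics (Cor. 1.5 ⟸ Thm. 1.4 + Kolyvagin–McCallum structure at depth t) typed at a general Heegner level
`N` in INDEX currency; its two stubs were registered on 20165 at 05:55Z before the planner saw g8's 05:43Z
registration and are kept only so that those registrations resolve to a statement. Stub provers: target the
RECORD's stubs. A proof of `stub_structure_depth_indexForm` here implies g8's `stub_structureIrred` only after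
the M₀ ↔ index bridge (McCallum 5.1, in tree), so nothing is gained by proving this variant first.
-/

/-!
# BC3 BIRTH SKELETON — crux `JetchevIrreducibleReadingByName` (item stmt-BirchSwinnertonDyer-20165;
# shared by KT = `Theses/KatoDescentTamePotSupersingular.lean` rev 22 and K9 =
# `Theses/KatoDescentPotSupersingular.lean` rev 21, rank 5 in both; planner bsd-potss-plan g21, 2026-08-27)

The crux is the BY-NAME alias of the D-audited READING
`Literature.NumberTheory.EllipticCurves.Jetchev2008.cor15_irreducibleReading_padicValNat_card_primaryComponent_sha_le`
(Jetchev 2008 Cor. 1.5 with Hypothesis (∗) «`p ∤ N`, `ρ̄_{E,p}` onto» replaced by «`p` odd ADDITIVE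
potentially good, `ρ̄_{E,p}` IRREDUCIBLE and the `p`-adic tower NOT onto, non-CM, lattice-optimal
datum of level `N` with Manin constant prime to `p`, `p ∤ c_p`, every `q′ ∣ N` with `p ∣ c_{q′}` exactly
divides `N`»; audit `pub/bsd-potss/ref/DAUDIT-SIGNOFF-Hsharp-Jetchev08-ref-g28.md`, flags F1/F2/F3).

THE CUT (= the printed proof of Cor. 1.5, p. 812: *"One obtains as an immediate consequence of the
above theorem [Thm. 1.4: `m_∞ ≥ m_max`] and Kolyvagin's formula"*; in the tree it is the composition
`Jetchev2008.padicValNat_card_sha_primary_add_le_of_thm14_of_mcCallum` of the two SURJECTIVE-image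
facts `Jetchev2008.thm14_derivedPoint_divisible_of_le_padicValNat_tamagawa` and
`McCallum1991_padicValNat_card_sha_primary_add_le_of_globalDivisibility`; here both halves are
re-typed in the reading's image / reduction regime and in the crux's INDEX currency
(`IsHeegnerPoint N W K P`, `[E(K) : ℤP]`), so that the composition below is literal):

* `stub_structure_depth_indexForm` (S1, the STRUCTURE half at depth `t`, size XL): for `W/ℚ` globally
  minimal non-CM, `K` imaginary quadratic with `d_K ∉ {−3, −4}` and the Heegner hypothesis for the level
  `N`, `p` odd with `W[p]` IRREDUCIBLE (no surjectivity, no hypothesis on the reduction at `p`), `P` a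
  Heegner point of level `N` of infinite order: if every derived Heegner point `P_n = d.derivedPoint`
  on every frame `(Dt, β, ι)` of level `N` is `p^s`-divisible in `E(K[n])` for every `s ≤ t` and every
  square-free product `n` of Kolyvagin primes `ℓ` with `s ≤ M(ℓ)` (global divisibility to depth `t`,
  i.e. `M_∞ ≥ t` in McCallum's currency), then `ord_p #Ш(E/K)[p^∞] + 2t ≤ 2·ord_p [E(K) : ℤP]`.
  SOURCES: Matar–Nekovář 2019 Thm. 0.7 + §0.11 (structure under irreducibility, `D_K ≠ −3, −4`,
  `p ≠ 2`) with the `m_i` of Kolyvagin, LNM 1479 (1991) Thm. 1 read as McCallum 1991 §5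
  (`M_r`, Cor. 5.6 `ord_p #Ш = 2(M_0 − m)`), Lemma 5.1 (`M_0 = ord_p [E(K) : ℤy_K]`); at `t = 0` it
  is the tree fact `MatarNekovar2019.thm03_padicValNat_card_sha_le_of_irreducible` (Ш-total form).
  The surjective-image twin IS the tree fact `McCallum1991_padicValNat_card_sha_primary_add_le_of_globalDivisibility`
  (frame/`M₀` currency). WHY IT MIGHT FAIL: flag F1 — the `m_i`-structure under irreducible-only image
  is MN19 §0.11's one-sentence extension of [Kol91, Thm. 1] (primary unread, acq-08093); the index
  reading `M₀ = ord_p [E(K) : ℤP]` needs `E(K)[p] = 0` (MN19 §0.4: irreducible ⇒ (c) for `p ≠ 2`) and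
  the frame-independence of non-torsion / divisibility (non-CM: every level-`N` parametrisation is
  `[n] ∘ φ₀`).
* `stub_thm14_irreducibleReading_depth` (S2, the DIVISIBILITY half = Jetchev Thm. 1.4 in the reading,
  size XL): under the crux's own binders (verbatim prefix, incl. the two audit guards `p ∤ c_p` and
  «`p ∣ c_{q′} ⇒ q′ ∥ N`») and for the displayed multiplicative Tamagawa prime `q ∥ N`, `q ≠ p`: global
  divisibility to depth `ord_p c_q` of every derived Heegner point on every frame of level `N` — the
  conclusion of `Jetchev2008.thm14_derivedPoint_divisible_of_le_padicValNat_tamagawa` VERBATIM (same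
  `KolyvaginHeegnerData` / `Zhang2014.IsKolyvaginPrime` / `kolyvaginIndex` vocabulary, level `N`).
  SOURCES: Jetchev 2008 Thm. 6.3 (minimal core vertex) + Prop. 6.4 (existence of core vertices) +
  Lemma 4.3 / Cor. 3.2 at `v ∣ q`, `v ∤ p` ([GZ86] III (3.1), flag F2) + Rem. 6.2 (irreducible image
  suffices for the Čebotarev / Selmer-structure steps, with MN19 Cor. 5.21 (e′), Prop. 5.26) + the ONE
  unprinted local step at `v ∣ p`: «`p ∤ c_p` ⇒ `H¹(K_v^{ur}/K_v, E)[p^∞] = 0` ⇒ the Kolyvagin classes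
  are Kummer-local at `v ∣ p`» (Lang; Milne ADT I.3.8; the pattern of Gross 1991 Prop. 6.2 (1)).
  WHY IT MIGHT FAIL: at an additive `v ∣ p` the identity component's special fibre is a unipotent group
  of `p`-power order, so the finite/Kummer condition at `v ∣ p` on `E[p^m]` is NOT the unramified one
  even when `p ∤ c_p`; Jetchev's core-vertex count uses self-duality of the Kummer structure at every
  place (fine) but his Lemma 4.3 comparison is only needed at `v ∣ q`; the risk is the Čebotarev step
  (McCallum §3 / Jetchev §5) with IRREDUCIBLE non-surjective image at `p = 3` (MN19 (α), (β) need
  `p ≥ 5` in places — Rem. 6.2 must be re-read; flag of the audit §2).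
The finer cut of S2 for a crux-plan line (not filed here): S2a = core-vertex divisibility GIVEN
Kummer-locality of the classes at `v ∣ p` (tree: `Jetchev2008.prop53_exists_coreVertex_of_depth_add_le_levelIndex`,
`CoreVerticesKernelShape.exists_isGlobalCoreVertex_of_prop53`, the abstract kernel
`Rank1Residual.JET.Section6.tamagawaExponent_le_mInfty_of_coreVertices`) and S3 = the `v ∣ p` local
lemma. The composition `JetchevIrreducibleReadingByName_of` is the literal modus ponens at
`t := ord_p c_q`; `…_of_K9` restates it for the K9 copy of the decl (same body). Nothing here is
asserted: two `sorry`s, both inside `stub_*`.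
-/

noncomputable section

open scoped Classical

open WeierstrassCurve Literature.NumberTheory.EllipticCurves
open Literature.NumberTheory.EllipticCurves.ModularForms
open Literature.NumberTheory.EllipticCurves.Rank1Residual

namespace Summit.BirchSwinnertonDyer.BirchSwinnertonDyer.Cruxes.JetchevIrreducibleReadingByName.Birth

/-- **Global `p`-divisibility of the derived Heegner points to depth `t` on every frame of level `N`**
(McCallum 1991 §5: `M_∞ ≥ t`; Jetchev 2008 §3.1: `m_∞ ≥ t`): for every frame `(Dt, β, ι)`, every
`s ≤ t`, every square-free `n` all of whose prime factors are Kolyvagin primes `ℓ` with `s ≤ M(ℓ)`,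
and every Kolyvagin–Heegner datum `d` of conductor `n`, `P_n = d.derivedPoint ∈ p^s E(K[n])`. The
shared interface of the two stubs (the conclusion shape of
`Jetchev2008.thm14_derivedPoint_divisible_of_le_padicValNat_tamagawa`, level generalised to `N`). -/
def GlobalDivisibilityToDepth (N : ℕ) [NeZero N] (W : WeierstrassCurve ℚ) [W.IsGloballyMinimal]
    (K : Type) [Field K] [NumberField K] (p t : ℕ) : Prop :=
  ∀ (Dt : ModularParametrizationData W N) (β : ℤ) (ι : K →+* ℂ) (s : ℕ), s ≤ t →
    ∀ (n : ℕ) (d : KolyvaginHeegnerData Dt β ι n), Squarefree n →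
      (∀ ℓ ∈ n.primeFactors, Zhang2014.IsKolyvaginPrime N W K p ℓ ∧
        s ≤ Zhang2014.kolyvaginIndex W p ℓ) →
      ∃ Q : (W.baseChange (ringClassField K ι n)).toAffine.Point,
        ((p ^ s : ℕ) : ℤ) • Q = d.derivedPoint

/-- Statement of `stub_structure_depth_indexForm` (S1): the Kolyvagin–McCallum structure half at depth
`t`, IRREDUCIBLE image, INDEX currency, any reduction type at `p`. [MatarNekovar2019 Thm. 0.7, §0.11,
§0.3–0.4; McCallumLMS1991 §5 Lemma 5.1, Cor. 5.6; Kolyvagin1991 LNM 1479 Thm. 1 (F1: primary unread)] -/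
abbrev Sig.stub_structure_depth_indexForm : Prop :=
  ∀ (N : ℕ) [NeZero N] (W : WeierstrassCurve ℚ) [W.IsElliptic] [W.IsGloballyMinimal]
    (K : Type) [Field K] [NumberField K],
    IsImaginaryQuadratic K → NumberField.discr K ≠ -3 → NumberField.discr K ≠ -4 →
    SatisfiesHeegnerHypothesis N K →
    ∀ (p : ℕ) [Fact p.Prime], p ≠ 2 → ¬ W.HasCM → W.HasIrreducibleModPGaloisRep p →
    ∀ {P : (W.baseChange K).toAffine.Point}, IsHeegnerPoint N W K P → ¬ IsOfFinAddOrder P →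
    ∀ (t : ℕ), GlobalDivisibilityToDepth N W K p t →
    padicValNat p (Nat.card (AddCommGroup.primaryComponent (W.baseChange K).sha p)) + 2 * t ≤
      2 * padicValNat p (AddSubgroup.zmultiples P).index

/-- Statement of `stub_thm14_irreducibleReading_depth` (S2): Jetchev's Thm. 1.4 in the reading — global
divisibility to depth `ord_p c_q` at ONE multiplicative Tamagawa prime `q ∥ N`, `q ≠ p`, under the
crux's binders verbatim. [Jetchev2008 Thm. 1.4, Thm. 6.3, Prop. 6.4, Lemma 4.3, Rem. 6.2 (F2: GZ86
III (3.1) unread); MilneADT2006 I.3.8; GrossLMS1991 Prop. 6.2 (1)] -/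
abbrev Sig.stub_thm14_irreducibleReading_depth : Prop :=
  ∀ (N : ℕ) [NeZero N] (W : WeierstrassCurve ℚ) [W.IsElliptic] [W.IsGloballyMinimal]
    (K : Type) [Field K] [NumberField K],
    IsImaginaryQuadratic K → NumberField.discr K ≠ -3 → NumberField.discr K ≠ -4 →
    SatisfiesHeegnerHypothesis N K →
    ∀ (p : ℕ) [Fact p.Prime], p ≠ 2 → W.analyticRank = 0 → Addv W p → 0 ≤ padicValRat p W.j →
    ¬ W.HasCM → W.HasIrreducibleModPGaloisRep p →
    ¬ (∀ n : ℕ, W.HasSurjectiveModNGaloisRep (p ^ n : ℕ)) →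
    (∃ Dt : ModularParametrizationData W N,
      (∀ z ∈ Dt.L.lattice, ∃ w ∈ periodLattice Dt.f, z = (Dt.c : ℂ) * w) ∧ ¬ (p : ℤ) ∣ Dt.c) →
    ¬ p ∣ (W.baseChange ℚ_[p]).localTamagawaNumber ℤ_[p] →
    (∀ (q' : ℕ) [Fact q'.Prime], q' ∣ N →
      p ∣ (W.baseChange ℚ_[q']).localTamagawaNumber ℤ_[q'] → ¬ q' ^ 2 ∣ N) →
    ∀ {P : (W.baseChange K).toAffine.Point}, IsHeegnerPoint N W K P → ¬ IsOfFinAddOrder P →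
    ∀ (q : ℕ) [Fact q.Prime], q ∣ N → ¬ q ^ 2 ∣ N → q ≠ p →
    GlobalDivisibilityToDepth N W K p
      (padicValNat p ((W.baseChange ℚ_[q]).localTamagawaNumber ℤ_[q]))

/-- S1 — registered stub (structure half at depth `t`, irreducible image, index form). -/
theorem stub_structure_depth_indexForm : Sig.stub_structure_depth_indexForm := by
  sorry

/-- S2 — registered stub (Jetchev Thm. 1.4 in the reading: divisibility to depth `ord_p c_q`). -/
theorem stub_thm14_irreducibleReading_depth : Sig.stub_thm14_irreducibleReading_depth := by
  sorry

/-- **The crux from the two stubs** (Cor. 1.5's printed proof: Thm. 1.4 feeds the structure half at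
`t = ord_p c_q`), concluding the KT route decl BY NAME. -/
theorem JetchevIrreducibleReadingByName_of (h₁ : Sig.stub_structure_depth_indexForm)
    (h₂ : Sig.stub_thm14_irreducibleReading_depth) :
    Summit.BirchSwinnertonDyer.BirchSwinnertonDyer.Theses.KatoDescentTamePotSupersingular.JetchevIrreducibleReadingByName := by
  unfold Summit.BirchSwinnertonDyer.BirchSwinnertonDyer.Theses.KatoDescentTamePotSupersingular.JetchevIrreducibleReadingByName
  intro N _ W _ _ K _ _ hK hD3 hD4 hH p _ hp2 hr hadd hj hcm hirr hns hopt hcp htam P hP hnt q _ hqN hq2 hqp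
  exact h₁ N W K hK hD3 hD4 hH p hp2 hcm hirr hP hnt _
    (h₂ N W K hK hD3 hD4 hH p hp2 hr hadd hj hcm hirr hns hopt hcp htam hP hnt q hqN hq2 hqp)

/-- The same composition concluding the K9 copy of the decl (shared item 20165; identical body). -/
theorem JetchevIrreducibleReadingByName_of_K9 (h₁ : Sig.stub_structure_depth_indexForm)
    (h₂ : Sig.stub_thm14_irreducibleReading_depth) :
    Summit.BirchSwinnertonDyer.BirchSwinnertonDyer.Theses.KatoDescentPotSupersingular.JetchevIrreducibleReadingByName := by
  unfold Summit.BirchSwinnertonDyer.BirchSwinnertonDyer.Theses.KatoDescentPotSupersingular.JetchevIrreducibleReadingByName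
  exact (by
    have h := JetchevIrreducibleReadingByName_of h₁ h₂
    unfold Summit.BirchSwinnertonDyer.BirchSwinnertonDyer.Theses.KatoDescentTamePotSupersingular.JetchevIrreducibleReadingByName at h
    exact h)

/-- Sanity (t = 0): S1 at depth `0` contains the Ш-primary shadow of the tree's MN19 Thm. 0.3 index
bound — the degenerate depth is NOT the crux (no Tamagawa exponent), recorded to show the depth
parameter is where the content sits. -/
theorem padicValNat_card_sha_primary_le_of_stub (h₁ : Sig.stub_structure_depth_indexForm)
    (N : ℕ) [NeZero N] (W : WeierstrassCurve ℚ) [W.IsElliptic] [W.IsGloballyMinimal]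
    (K : Type) [Field K] [NumberField K] (hK : IsImaginaryQuadratic K)
    (hD3 : NumberField.discr K ≠ -3) (hD4 : NumberField.discr K ≠ -4)
    (hH : SatisfiesHeegnerHypothesis N K) (p : ℕ) [Fact p.Prime] (hp2 : p ≠ 2) (hcm : ¬ W.HasCM)
    (hirr : W.HasIrreducibleModPGaloisRep p) {P : (W.baseChange K).toAffine.Point}
    (hP : IsHeegnerPoint N W K P) (hnt : ¬ IsOfFinAddOrder P) :
    padicValNat p (Nat.card (AddCommGroup.primaryComponent (W.baseChange K).sha p)) ≤
      2 * padicValNat p (AddSubgroup.zmultiples P).index := by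
  have h := h₁ N W K hK hD3 hD4 hH p hp2 hcm hirr hP hnt 0 (by
    intro Dt β ι s hs n d _ _
    obtain rfl : s = 0 := Nat.le_zero.mp hs
    exact ⟨d.derivedPoint, by rw [pow_zero, Nat.cast_one, one_smul]⟩)
  omega

end Summit.BirchSwinnertonDyer.BirchSwinnertonDyer.Cruxes.JetchevIrreducibleReadingByName.Birth

end
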